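import Summits.ResolutionOfSingularities.ResolutionOfSingularities.Theorems.FrobeniusLadderFInjectiveMacaulayficationT11OriginNotClauseChar7
import Summits.ResolutionOfSingularities.ResolutionOfSingularities.Theorems.FrobeniusLadderFInjectiveMacaulayficationFCForallExistsCylinderAntecedent
import Summits.ResolutionOfSingularities.ResolutionOfSingularities.Theorems.FrobeniusLadderFInjectiveMacaulayficationFCForallExistsCylinderT11Char7
import Summits.ResolutionOfSingularities.ResolutionOfSingularities.Theorems.FrobeniusLadderFInjectiveMacaulayficationT11PlusOriginTransport
import Summits.ResolutionOfSingularities.ResolutionOfSingularities.Theorems.FrobeniusLadderFInjectiveMacaulayficationT11SpecimenDoor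
import Summits.ResolutionOfSingularities.ResolutionOfSingularities.Theorems.FrobeniusLadderFInjectiveMacaulayficationBlowupFiModelOfCover
import HarnessLib

/-!
# The FC′/FC″ antecedent at the cylinder point of `T₁₁⁺ × 𝔸¹`, characteristic `7`: rung r1 is TIGHT (crux `FInjectiveMacaulayfication`)

Support file for crux stmt-ResolutionOfSingularities-15315 (`FrobeniusLadder.FInjectiveMacaulayfication`), chain w45a. [OURS · L1 W4.5a] —
NOT a statement of any manuscript [claim: Hironaka2017]; AI-written, weaker than expert review; no statement of the manuscript is used.

The FC′ cylinder instance `FCForallExistsCylinderT11Char7.fcForallExists_body_T11plus_cylinder_char7` (p533666) proves the seven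
conjuncts of the CONCLUSION of the door stubs FC′ = `GenericFibreReduction.FCForallExists` / FC″ = `GenericFibreReduction.FCUnguarded`
at `(X₁, η) = (T₁₁⁺ × 𝔸¹, generic point of {0} × 𝔸¹)` over every field of characteristic `7`, and
`FCForallExistsCylinderAntecedent.cylinder_antecedent` (p540202) reduces the three HYPOTHESES of those stubs at a cylinder point —
`η` non-closed, `η` F-bad, every proper generization of `η` F-good — to the F-badness of the SCHEME STALK at the base point `y₀` plus
the clause off `y₀`. This file supplies that F-badness for the origin of `T₁₁⁺ = V(Φ − y² − x³, z² + Φ³ + x¹¹ + w⁷) ⊂ 𝔸⁵` in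
characteristic `7` and assembles the antecedent, so that rung r1 of FC′/FC″ is TIGHT in the tree: hypotheses AND conclusion hold at
the same `(X₁, η)`, by kernel-checked files only (no named fact).

Chain of transports (all tree lemmas): Fedder's computation `T11OriginNotClauseChar7.t11_origin_not_clause` (p544411: the local ring of
the hypersurface `T₁₁ = V(z² + (y²+x³)³ + x¹¹ + w⁷) ⊂ 𝔸⁴` at the origin violates the clause, `(T₁₁)^6 ∈ (x⁷,y⁷,z⁷,w⁷)`) ⟶ the `Fin 1` /
`Set.range` presentation of the same ring (`Ideal.quotEquivOfEq` + `BlowupFiModelOfCover.nonempty_ringEquiv_localization_of_ringEquiv`) ⟶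
the origin of the complete-intersection model `T₁₁⁺` (`T11PlusOriginTransport.nonempty_originLocalization_ringEquiv`, elimination of `Φ`) ⟶
the F-ONLY clause fails there, because the CM half holds (`T11SpecimenDoor.cmClause_of_isMaximal`, `T₁₁⁺` is a complete intersection) ⟶
the scheme stalk (`Spec.stalkIso`, `FiLocusOpenOfAffine.fClause_of_ringEquiv`) ⟶ `cylinder_antecedent` with
`hoff = FCForallExistsCylinderT11Char7.t11Plus_hoff_atPrime_char7`.

* `t11_origin_not_clause_range` — `¬ clause₇` at the origin of `k[x,y,z,w]/(Gs 0)`, `Gs : Fin 1 → _`, `Gs 0 = T₁₁` (range presentation);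
* `t11plus_not_clause_of_eq_origin` — `¬ clause₇ (Localization.AtPrime Q)` for the origin `Q` of `T₁₁⁺`;
* `t11plus_not_fClause_of_eq_origin` — the F-only clause already fails there (CM holds);
* `t11plus_cylinder_antecedent_char7` — **the three hypotheses of FC′/FC″ at the cylinder point `η` of `T₁₁⁺ × 𝔸¹`, char `7`.**
-/

-- single-problem summit: the doubled namespace component is forced
set_option linter.dupNamespace false

noncomputable section

open Polynomial AlgebraicGeometry IsLocalRing

namespace Summit.ResolutionOfSingularities.ResolutionOfSingularities.Theorems.FInjectiveMacaulayfication.T11PlusCylinderAntecedentChar7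

open Summit.ResolutionOfSingularities.ResolutionOfSingularities.Theorems.FInjectiveMacaulayfication

variable (k : Type) [Field k]

/-! ## §1 The hypersurface origin in the `Set.range` presentation -/

/-- **`T₁₁` IS BAD AT ITS ORIGIN (char `7`), `Fin 1` / `Set.range` presentation**: for `Gs : Fin 1 → k[x,y,z,w]` with
`Gs 0 = z² + (y²+x³)³ + x¹¹ + w⁷`, the local ring of `k[x,y,z,w]/(Set.range Gs)` at the image `𝔪̄` of `(x,y,z,w)` violates the clause
(every s.o.p. weakly regular with Frobenius-closed ideal, `p = 7`). = `T11OriginNotClauseChar7.t11_origin_not_clause` (presentation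
`k[X]/(f)`) moved along `k[X]/(f) ≃ k[X]/(Set.range Gs)` (`Ideal.quotEquivOfEq`, `Set.range Gs = {Gs 0}`) and the induced isomorphism of
the localizations at the two origins. [cite: Fedder1983, Thm. 1.12] -/
theorem t11_origin_not_clause_range [CharP k 7] (Gs : Fin 1 → MvPolynomial (Fin 4) k)
    (hG : Gs 0 = MvPolynomial.X 2 ^ 2 + (MvPolynomial.X 1 ^ 2 + MvPolynomial.X 0 ^ 3) ^ 3 + MvPolynomial.X 0 ^ 11 + MvPolynomial.X 3 ^ 7)
    [hH : (Ideal.span (Set.range fun i : Fin 4 => Ideal.Quotient.mk (Ideal.span (Set.range Gs)) (MvPolynomial.X i))).IsPrime] :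
    ¬ (∀ d : ℕ, ringKrullDim (Localization.AtPrime
        (Ideal.span (Set.range fun i : Fin 4 => Ideal.Quotient.mk (Ideal.span (Set.range Gs)) (MvPolynomial.X i)))) = d →
      ∀ s : Fin d → Localization.AtPrime
          (Ideal.span (Set.range fun i : Fin 4 => Ideal.Quotient.mk (Ideal.span (Set.range Gs)) (MvPolynomial.X i))),
        (Ideal.span (Set.range s)).radical.IsMaximal →
          RingTheory.Sequence.IsWeaklyRegular (Localization.AtPrime
            (Ideal.span (Set.range fun i : Fin 4 => Ideal.Quotient.mk (Ideal.span (Set.range Gs)) (MvPolynomial.X i)))) (List.ofFn s) ∧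
          ∀ y : Localization.AtPrime
              (Ideal.span (Set.range fun i : Fin 4 => Ideal.Quotient.mk (Ideal.span (Set.range Gs)) (MvPolynomial.X i))),
            (∃ e : ℕ, y ^ 7 ^ e ∈ Ideal.span ((fun z : Localization.AtPrime
                (Ideal.span (Set.range fun i : Fin 4 => Ideal.Quotient.mk (Ideal.span (Set.range Gs)) (MvPolynomial.X i))) => z ^ 7 ^ e) ''
              (Ideal.span (Set.range s) : Set (Localization.AtPrime
                (Ideal.span (Set.range fun i : Fin 4 => Ideal.Quotient.mk (Ideal.span (Set.range Gs)) (MvPolynomial.X i))))))) →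
            y ∈ Ideal.span (Set.range s)) := by
  haveI : Fact (Nat.Prime 7) := ⟨by norm_num⟩
  -- the `k[X]/(f)` presentation
  obtain ⟨P, hPmax, hPeq, hbad⟩ := T11OriginNotClauseChar7.t11_origin_not_clause k (Gs 0) hG
  have hI : Ideal.span {Gs 0} = Ideal.span (Set.range Gs) := by
    rw [T11PlusOriginTransport.range_fin_one]
  have hS1 : Ideal.span {Gs 0} ≤ Ideal.span (Set.range (MvPolynomial.X : Fin 4 → MvPolynomial (Fin 4) k)) := by
    rw [Ideal.span_singleton_le_iff_mem, hG]
    exact T11OriginNotClauseChar7.t11_mem_span_range_X k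
  have hS2 : Ideal.span (Set.range Gs) ≤ Ideal.span (Set.range (MvPolynomial.X : Fin 4 → MvPolynomial (Fin 4) k)) := hI ▸ hS1
  have hH' : Ideal.span (Set.range fun i : Fin 4 => Ideal.Quotient.mk (Ideal.span (Set.range Gs)) (MvPolynomial.X i)) =
      (Ideal.span (Set.range (MvPolynomial.X : Fin 4 → MvPolynomial (Fin 4) k))).map (Ideal.Quotient.mk (Ideal.span (Set.range Gs))) := by
    rw [Ideal.map_span, ← Set.range_comp]
    rfl
  -- the two origins correspond under `quotEquivOfEq`
  have hmem : ∀ x : MvPolynomial (Fin 4) k ⧸ Ideal.span {Gs 0}, Ideal.quotEquivOfEq hI x ∈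
      Ideal.span (Set.range fun i : Fin 4 => Ideal.Quotient.mk (Ideal.span (Set.range Gs)) (MvPolynomial.X i)) ↔ x ∈ P := by
    intro x
    obtain ⟨a, rfl⟩ := Ideal.Quotient.mk_surjective x
    rw [hH', hPeq, Ideal.quotEquivOfEq_mk, Ideal.mem_quotient_iff_mem hS2, Ideal.mem_quotient_iff_mem hS1]
  obtain ⟨eL⟩ := BlowupFiModelOfCover.nonempty_ringEquiv_localization_of_ringEquiv (Ideal.quotEquivOfEq hI) P _ hmem
  intro hclause
  exact hbad (DegreeZeroDescent.inlineClause_of_ringEquiv 7 eL.symm hclause)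

/-! ## §2 The origin of the complete-intersection model `T₁₁⁺` -/

/-- **`T₁₁⁺` IS BAD AT ITS ORIGIN (char `7`)**: for `Fs = (Φ − y² − x³, z² + Φ³ + x¹¹ + w⁷)` and the origin `Q = (x̄,ȳ,z̄,w̄,Φ̄)` of
`k[x,y,z,w,Φ]/(Fs)`, the local ring `(k[X]/(Fs))_Q` violates the clause — `t11_origin_not_clause_range` transported along the isomorphism of
the local rings at the two origins `T11PlusOriginTransport.nonempty_originLocalization_ringEquiv` (elimination of `Φ = y² + x³`).
[cite: Fedder1983, Thm. 1.12] -/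
theorem t11plus_not_clause_of_eq_origin [CharP k 7] (Fs : Fin 2 → MvPolynomial (Fin 5) k)
    (hF₀ : Fs 0 = MvPolynomial.X 4 - MvPolynomial.X 1 ^ 2 - MvPolynomial.X 0 ^ 3)
    (hF₁ : Fs 1 = MvPolynomial.X 2 ^ 2 + MvPolynomial.X 4 ^ 3 + MvPolynomial.X 0 ^ 11 + MvPolynomial.X 3 ^ 7)
    (Q : Ideal (MvPolynomial (Fin 5) k ⧸ Ideal.span (Set.range Fs))) [Q.IsPrime]
    (hQ : Q = Ideal.span (Set.range fun i : Fin 5 => Ideal.Quotient.mk (Ideal.span (Set.range Fs)) (MvPolynomial.X i))) :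
    ¬ (∀ d : ℕ, ringKrullDim (Localization.AtPrime Q) = d → ∀ s : Fin d → Localization.AtPrime Q,
        (Ideal.span (Set.range s)).radical.IsMaximal →
          RingTheory.Sequence.IsWeaklyRegular (Localization.AtPrime Q) (List.ofFn s) ∧
          ∀ y : Localization.AtPrime Q, (∃ e : ℕ, y ^ 7 ^ e ∈ Ideal.span ((fun z : Localization.AtPrime Q => z ^ 7 ^ e) ''
            (Ideal.span (Set.range s) : Set (Localization.AtPrime Q)))) → y ∈ Ideal.span (Set.range s)) := by
  haveI : Fact (Nat.Prime 7) := ⟨by norm_num⟩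
  subst hQ
  haveI : (Ideal.span (Set.range fun i : Fin 4 => Ideal.Quotient.mk (Ideal.span (Set.range
      (![MvPolynomial.X 2 ^ 2 + (MvPolynomial.X 1 ^ 2 + MvPolynomial.X 0 ^ 3) ^ 3 + MvPolynomial.X 0 ^ 11 + MvPolynomial.X 3 ^ 7] :
        Fin 1 → MvPolynomial (Fin 4) k))) (MvPolynomial.X i))).IsPrime :=
    (QuotientOriginMaximal.isMaximal_span_range_mk_X k
      (![MvPolynomial.X 2 ^ 2 + (MvPolynomial.X 1 ^ 2 + MvPolynomial.X 0 ^ 3) ^ 3 + MvPolynomial.X 0 ^ 11 + MvPolynomial.X 3 ^ 7] :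
        Fin 1 → MvPolynomial (Fin 4) k)
      (fun l => by fin_cases l; simp [MvPolynomial.constantCoeff_X])).isPrime
  obtain ⟨e⟩ := T11PlusOriginTransport.nonempty_originLocalization_ringEquiv k Fs hF₀ hF₁
    (![MvPolynomial.X 2 ^ 2 + (MvPolynomial.X 1 ^ 2 + MvPolynomial.X 0 ^ 3) ^ 3 + MvPolynomial.X 0 ^ 11 + MvPolynomial.X 3 ^ 7] :
      Fin 1 → MvPolynomial (Fin 4) k) rfl
  intro hclause
  -- (the carrier types are pinned so that the ring-structure instances of `e` unify by reduction)
  have key := DegreeZeroDescent.inlineClause_of_ringEquiv 7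
    (L := Localization.AtPrime (Ideal.span (Set.range fun i : Fin 5 => Ideal.Quotient.mk (Ideal.span (Set.range Fs)) (MvPolynomial.X i))))
    (L' := Localization.AtPrime (Ideal.span (Set.range fun i : Fin 4 => Ideal.Quotient.mk (Ideal.span (Set.range
      (![MvPolynomial.X 2 ^ 2 + (MvPolynomial.X 1 ^ 2 + MvPolynomial.X 0 ^ 3) ^ 3 + MvPolynomial.X 0 ^ 11 + MvPolynomial.X 3 ^ 7] :
        Fin 1 → MvPolynomial (Fin 4) k))) (MvPolynomial.X i))))
    e hclause
  exact t11_origin_not_clause_range k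
    (![MvPolynomial.X 2 ^ 2 + (MvPolynomial.X 1 ^ 2 + MvPolynomial.X 0 ^ 3) ^ 3 + MvPolynomial.X 0 ^ 11 + MvPolynomial.X 3 ^ 7] :
      Fin 1 → MvPolynomial (Fin 4) k) rfl key

/-- **THE F-ONLY CLAUSE ALREADY FAILS AT THE ORIGIN OF `T₁₁⁺` (char `7`)**: `T₁₁⁺` is a complete intersection, so every local ring of it is
Cohen–Macaulay in the clause sense (`T11SpecimenDoor.cmClause_of_isMaximal`); with `t11plus_not_clause_of_eq_origin` the Frobenius half
must fail: some system of parameters of `(k[X]/(Fs))_Q` generates an ideal that is not Frobenius closed. [cite: Fedder1983, Thm. 1.12]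
[cite: Matsumura1987, Thm. 17.4] -/
theorem t11plus_not_fClause_of_eq_origin [CharP k 7] (Fs : Fin 2 → MvPolynomial (Fin 5) k)
    (hF₀ : Fs 0 = MvPolynomial.X 4 - MvPolynomial.X 1 ^ 2 - MvPolynomial.X 0 ^ 3)
    (hF₁ : Fs 1 = MvPolynomial.X 2 ^ 2 + MvPolynomial.X 4 ^ 3 + MvPolynomial.X 0 ^ 11 + MvPolynomial.X 3 ^ 7)
    (Q : Ideal (MvPolynomial (Fin 5) k ⧸ Ideal.span (Set.range Fs))) [Q.IsPrime]
    (hQ : Q = Ideal.span (Set.range fun i : Fin 5 => Ideal.Quotient.mk (Ideal.span (Set.range Fs)) (MvPolynomial.X i))) :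
    ¬ (∀ d : ℕ, ringKrullDim (Localization.AtPrime Q) = d → ∀ s : Fin d → Localization.AtPrime Q,
        (Ideal.span (Set.range s)).radical.IsMaximal →
          ∀ y : Localization.AtPrime Q, (∃ e : ℕ, y ^ 7 ^ e ∈ Ideal.span ((fun z : Localization.AtPrime Q => z ^ 7 ^ e) ''
            (Ideal.span (Set.range s) : Set (Localization.AtPrime Q)))) → y ∈ Ideal.span (Set.range s)) := by
  intro hF
  have hmax : Q.IsMaximal := by
    rw [hQ]
    exact QuotientOriginMaximal.isMaximal_span_range_mk_X k Fs (T11SpecimenDoorGeneric.constantCoeff_eq_zero Fs hF₀ hF₁)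
  have hCM := T11SpecimenDoor.cmClause_of_isMaximal (Fs 0) (Fs 1) hF₀ hF₁ (Set.range Fs)
    (T11SpecimenDoorGeneric.range_eq_list Fs) Q hmax
  exact t11plus_not_clause_of_eq_origin k Fs hF₀ hF₁ Q hQ fun d hd s hs => ⟨hCM d hd s hs, hF d hd s hs⟩

/-! ## §3 The antecedent of FC′/FC″ at the cylinder point -/

/-- **THE HYPOTHESES OF FC′/FC″ HOLD AT THE CYLINDER POINT OF `T₁₁⁺ × 𝔸¹` OVER EVERY FIELD OF CHARACTERISTIC `7` — rung r1 is TIGHT.**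
For `R = k[x,y,z,w,Φ]/(Φ−y²−x³, z²+Φ³+x¹¹+w⁷)`, `char k = 7`, `y₀ =` the origin of `Spec R` and `η = 𝔪_{y₀}·R[t] ∈ Spec R[t] = T₁₁⁺ × 𝔸¹`:
`η` is NOT closed, the stalk `𝒪_{X₁,η}` is F-BAD (some system of parameters generates an ideal that is not Frobenius closed), and every
proper generization of `η` is F-GOOD — literally the three hypotheses on `η` of `GenericFibreReduction.FCForallExists` / `FCUnguarded`,
whose conclusion at the same `(X₁, η)` is `FCForallExistsCylinderT11Char7.fcForallExists_body_T11plus_cylinder_char7`. Assembly: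
`FCForallExistsCylinderAntecedent.cylinder_antecedent` with `hoff = t11Plus_hoff_atPrime_char7` and `hbad = t11plus_not_fClause_of_eq_origin`
moved to the scheme stalk along `Spec.stalkIso`. Axioms standard; no named fact. [OURS · L1 W4.5a; folklore assembly]
[cite: Fedder1983, Thm. 1.12; Prop. 2.1] [cite: Matsumura1987, Thm. 7.5] -/
theorem t11plus_cylinder_antecedent_char7 [CharP k 7] (Fs : Fin 2 → MvPolynomial (Fin 5) k)
    (hF₀ : Fs 0 = MvPolynomial.X 4 - MvPolynomial.X 1 ^ 2 - MvPolynomial.X 0 ^ 3)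
    (hF₁ : Fs 1 = MvPolynomial.X 2 ^ 2 + MvPolynomial.X 4 ^ 3 + MvPolynomial.X 0 ^ 11 + MvPolynomial.X 3 ^ 7)
    (y₀ : Spec (.of (MvPolynomial (Fin 5) k ⧸ Ideal.span (Set.range Fs))))
    (hy₀ : y₀.asIdeal = Ideal.span (Set.range fun j : Fin 5 => Ideal.Quotient.mk (Ideal.span (Set.range Fs)) (MvPolynomial.X j)))
    (η : Spec (.of (MvPolynomial (Fin 5) k ⧸ Ideal.span (Set.range Fs))[X]))
    (hη : η.asIdeal = y₀.asIdeal.map (C : (MvPolynomial (Fin 5) k ⧸ Ideal.span (Set.range Fs)) →+*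
      (MvPolynomial (Fin 5) k ⧸ Ideal.span (Set.range Fs))[X])) :
    ¬ IsClosed ({η} : Set (Spec (.of (MvPolynomial (Fin 5) k ⧸ Ideal.span (Set.range Fs))[X]))) ∧
    ¬ (∀ d : ℕ, ringKrullDim ((Spec (.of (MvPolynomial (Fin 5) k ⧸ Ideal.span (Set.range Fs))[X])).presheaf.stalk η) = d →
        ∀ s : Fin d → (Spec (.of (MvPolynomial (Fin 5) k ⧸ Ideal.span (Set.range Fs))[X])).presheaf.stalk η,
        (Ideal.span (Set.range s)).radical.IsMaximal →
          ∀ t : (Spec (.of (MvPolynomial (Fin 5) k ⧸ Ideal.span (Set.range Fs))[X])).presheaf.stalk η, (∃ e : ℕ, t ^ 7 ^ e ∈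
            Ideal.span ((fun z : (Spec (.of (MvPolynomial (Fin 5) k ⧸ Ideal.span (Set.range Fs))[X])).presheaf.stalk η => z ^ 7 ^ e) ''
              (Ideal.span (Set.range s) :
                Set ((Spec (.of (MvPolynomial (Fin 5) k ⧸ Ideal.span (Set.range Fs))[X])).presheaf.stalk η)))) → t ∈ Ideal.span (Set.range s)) ∧
    ∀ y : Spec (.of (MvPolynomial (Fin 5) k ⧸ Ideal.span (Set.range Fs))[X]), y ⤳ η → y ≠ η →
      ∀ d : ℕ, ringKrullDim ((Spec (.of (MvPolynomial (Fin 5) k ⧸ Ideal.span (Set.range Fs))[X])).presheaf.stalk y) = d →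
        ∀ s : Fin d → (Spec (.of (MvPolynomial (Fin 5) k ⧸ Ideal.span (Set.range Fs))[X])).presheaf.stalk y,
        (Ideal.span (Set.range s)).radical.IsMaximal →
          ∀ t : (Spec (.of (MvPolynomial (Fin 5) k ⧸ Ideal.span (Set.range Fs))[X])).presheaf.stalk y, (∃ e : ℕ, t ^ 7 ^ e ∈
            Ideal.span ((fun z : (Spec (.of (MvPolynomial (Fin 5) k ⧸ Ideal.span (Set.range Fs))[X])).presheaf.stalk y => z ^ 7 ^ e) ''
              (Ideal.span (Set.range s) :
                Set ((Spec (.of (MvPolynomial (Fin 5) k ⧸ Ideal.span (Set.range Fs))[X])).presheaf.stalk y)))) → t ∈ Ideal.span (Set.range s) := by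
  haveI : Fact (Nat.Prime 7) := ⟨by norm_num⟩
  haveI : (Ideal.span (Set.range Fs)).IsPrime := (T11PlusPrime.t11plus_prime_and_X_ne_zero k Fs hF₀ hF₁).1
  haveI : IsDomain (MvPolynomial (Fin 5) k ⧸ Ideal.span (Set.range Fs)) := Ideal.Quotient.isDomain _
  haveI : CharP (MvPolynomial (Fin 5) k ⧸ Ideal.span (Set.range Fs)) 7 :=
    charP_of_injective_algebraMap (algebraMap k (MvPolynomial (Fin 5) k ⧸ Ideal.span (Set.range Fs))).injective 7
  -- the origin is a closed point
  have hcl : IsClosed ({y₀} : Set (Spec (.of (MvPolynomial (Fin 5) k ⧸ Ideal.span (Set.range Fs))))) := by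
    refine (PrimeSpectrum.isClosed_singleton_iff_isMaximal y₀).mpr ?_
    rw [hy₀]
    exact QuotientOriginMaximal.isMaximal_span_range_mk_X k Fs (T11SpecimenDoorGeneric.constantCoeff_eq_zero Fs hF₀ hF₁)
  -- the scheme stalk at the origin is F-bad: move to `Localization.AtPrime y₀.asIdeal` along `Spec.stalkIso`
  have hbad : ¬ (∀ d : ℕ, ringKrullDim ((Spec (.of (MvPolynomial (Fin 5) k ⧸ Ideal.span (Set.range Fs)))).presheaf.stalk y₀) = d →
      ∀ s : Fin d → (Spec (.of (MvPolynomial (Fin 5) k ⧸ Ideal.span (Set.range Fs)))).presheaf.stalk y₀,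
        (Ideal.span (Set.range s)).radical.IsMaximal →
          ∀ t : (Spec (.of (MvPolynomial (Fin 5) k ⧸ Ideal.span (Set.range Fs)))).presheaf.stalk y₀, (∃ e : ℕ, t ^ 7 ^ e ∈
            Ideal.span ((fun z : (Spec (.of (MvPolynomial (Fin 5) k ⧸ Ideal.span (Set.range Fs)))).presheaf.stalk y₀ => z ^ 7 ^ e) ''
              (Ideal.span (Set.range s) :
                Set ((Spec (.of (MvPolynomial (Fin 5) k ⧸ Ideal.span (Set.range Fs)))).presheaf.stalk y₀)))) → t ∈ Ideal.span (Set.range s)) :=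
    fun hgood => t11plus_not_fClause_of_eq_origin k Fs hF₀ hF₁ y₀.asIdeal hy₀
      (FiLocusOpenOfAffine.fClause_of_ringEquiv 7 (A := (Spec (.of (MvPolynomial (Fin 5) k ⧸ Ideal.span (Set.range Fs)))).presheaf.stalk y₀)
        (B := Localization.AtPrime y₀.asIdeal)
        (Spec.stalkIso (.of (MvPolynomial (Fin 5) k ⧸ Ideal.span (Set.range Fs))) y₀).commRingCatIsoToRingEquiv hgood)
  exact FCForallExistsCylinderAntecedent.cylinder_antecedent 7 (MvPolynomial (Fin 5) k ⧸ Ideal.span (Set.range Fs)) y₀ hcl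
    (FCForallExistsCylinderT11Char7.t11Plus_hoff_atPrime_char7 k Fs hF₀ hF₁ y₀ hy₀) hbad η hη

end Summit.ResolutionOfSingularities.ResolutionOfSingularities.Theorems.FInjectiveMacaulayfication.T11PlusCylinderAntecedentChar7

end
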